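import Summits.ResolutionOfSingularities.ResolutionOfSingularities.Theorems.FrobeniusClosingPatchingRelPerfectDepthLegalEntry
import Summits.ResolutionOfSingularities.ResolutionOfSingularities.Theorems.FrobeniusClosingPatchingRelPerfectDepthEndTwoMonomialGlue
import Literature.AlgebraicGeometry.Resolution.MarkedIdealsRestrict
import HarnessLib

/-!
# Crux `PatchingRelPerfect` (stmt-ResolutionOfSingularities-16161), chain W5.2 — T6-E1b residual, `LegalPhaseTwo₃` closer (2b):
# the separation game runs on the POSITIVE part of the boundary list (OWNER NOTE O4.1)

[OURS · L1 W5.2 · res-L1-w52-idea-1 g9 (OWNER of the `LegalScopedDivisorReduction₃` design), text for a hand to file; OWNER NOTE O4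
2026-08-27T13:39:39Z on res-L1-w52-lead-1's STEP B spec `PHASE2-STEPB-SPEC.md` e2551fbadb1130d7] Replaces the role of NO printed item;
NOT a statement of the manuscript under review; fact-free.

WHY.  `boundaryOf L` lists every member of the exponent list, exponent `0` included, so the normal-crossings hypothesis
`HasSNCWith (boundaryOf L) 𝓘(Z)` of `DepthLegal.HostState.step` constrains the centre by exponent-zero members, while the trace
`(monomialIdeal L)|_X`, its order measure and STEP A never see them (`K ^ 0 = ⊤`).  On the state `H = (xz)`, `D = (z)`,
`ℬ = [(𝓘V(x), 1), (𝓘V(z - y²), 0)]` of `𝔸³` (a legitimate `HostBoundary₃` state) the only trace curve `V(x, z)` is not normal crossings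
with `boundaryOf ℬ` at the origin and the curve-move loop has no move.  Remedy: run the game on `L⁺ := L.filter (0 < ·.2)` — the
monomial ideal, hence `H = D · M`, the trace, the weights and the final `SncSupport`, are unchanged, and a sub-list of a simple normal
crossings list is simple normal crossings.

* `HostState.filter_pos : HostState H D L → HostState H D (L.filter fun p => decide (0 < p.2))`;
* `weightAt_filter_pos` — the legality weight is unchanged;
* `exists_hostState_pos_of_hostBoundary₃` — ENTRY (res-D-pv-054's `exists_hostState_of_hostBoundary₃`, p534768) with all exponents positive.

AI-written; AI review is weaker than expert review.

## References
* E. Bierstone, D. Grigoriev, P. Milman, J. Włodarczyk, arXiv:1206.3090, §4 Step 1a (forgetting boundary components keeps snc).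
  [BierstoneGrigorievMilmanWlodarczyk2011]
* J. Kollár, *Lectures on Resolution of Singularities* (2007), (3.111) Step 3. [Kollar2007]
-/

-- `Summit.<Summit>.<Sub>.Theorems` with `Sub = Summit` (single-conjunct summit, D-0017)
set_option linter.dupNamespace false

noncomputable section

open CategoryTheory CategoryTheory.Limits AlgebraicGeometry TopologicalSpace IsLocalRing
open Literature.AlgebraicGeometry.Resolution Scheme.IdealSheafData

namespace Summit.ResolutionOfSingularities.ResolutionOfSingularities.Theorems

universe u

namespace DepthLegal

open WeightTwoB DepthTargets

variable {E : Scheme.{u}}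

/-- The boundary of the positive part is a sub-list of the boundary. [folklore] -/
theorem boundaryOf_filter_sublist (L : List (E.IdealSheafData × ℕ)) (f : E.IdealSheafData × ℕ → Bool) :
    (boundaryOf (L.filter f)).Sublist (boundaryOf L) :=
  List.filter_sublist.map Prod.fst

/-- **The legality weight ignores exponent-zero members.** [folklore] -/
theorem weightAt_filter_pos (L : List (E.IdealSheafData × ℕ)) (x : E) :
    weightAt (L.filter fun p => decide (0 < p.2)) x = weightAt L x := by
  classical
  induction L with
  | nil => rw [List.filter_nil]
  | cons p L ih =>
    by_cases hp : 0 < p.2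
    · rw [List.filter_cons_of_pos (by simpa using hp), weightAt_cons, weightAt_cons, ih]
    · rw [List.filter_cons_of_neg (by simpa using hp), ih, weightAt_cons, Nat.eq_zero_of_not_pos hp]
      split_ifs <;> simp

/-- Every member of the positive part has positive exponent. [folklore] -/
theorem pos_of_mem_filter_pos {L : List (E.IdealSheafData × ℕ)} {p : E.IdealSheafData × ℕ}
    (hp : p ∈ L.filter fun p => decide (0 < p.2)) : 0 < p.2 := by
  simpa using List.of_mem_filter hp

/-- [OURS · L1 W5.2] **The separation game runs on the positive part of the boundary list** (OWNER NOTE O4.1): dropping the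
exponent-zero members keeps the STEP-B state — same host, same monomial (`DepthSNC.monomialIdeal_filter_pos`), and a sub-list of a
simple-normal-crossings list has simple normal crossings (`HasSNCWith.sublist`).
[cite: BierstoneGrigorievMilmanWlodarczyk2011, §4 Step 1a] -/
theorem HostState.filter_pos [IsLocallyNoetherian E] {H D : E.IdealSheafData} {L : List (E.IdealSheafData × ℕ)}
    (S : HostState H D L) : HostState H D (L.filter fun p => decide (0 < p.2)) where
  regE := S.regE
  fac := by rw [DepthSNC.monomialIdeal_filter_pos]; exact S.fac
  hostCartier := S.hostCartier
  hostHyp := S.hostHyp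
  sncB := HasSNCWith.sublist (boundaryOf_filter_sublist L _) S.sncB

/-- [OURS · L1 W5.2] **ENTRY with positive exponents**, ∃-packaged from `HostBoundary₃` (res-D-pv-054's
`exists_hostState_of_hostBoundary₃` followed by `HostState.filter_pos`): a STEP-B host state all of whose boundary members have
POSITIVE exponent and irreducible support not inside the host, with the host's zero-scheme regular and the host reduced.
[cite: CossartJannsenSaito2020, Thm. 1.4] -/
theorem exists_hostState_pos_of_hostBoundary₃ [IsNoetherian E] {H : E.IdealSheafData} (h : HostBoundary₃ E H) :
    ∃ (D : E.IdealSheafData) (ℬ : List (E.IdealSheafData × ℕ)), HostState H D ℬ ∧ (∀ p ∈ ℬ, 0 < p.2) ∧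
      (∀ p ∈ ℬ, IsIrreducible (p.1.support : Set E) ∧ ¬ ((p.1.support : Set E) ⊆ D.support)) ∧
      Scheme.IsRegular D.subscheme ∧ D = vanishingIdeal D.support := by
  obtain ⟨D, ℬ, S, hmem, hreg, hrad⟩ := exists_hostState_of_hostBoundary₃ h
  exact ⟨D, _, S.filter_pos, fun p hp => pos_of_mem_filter_pos hp,
    fun p hp => hmem p (List.mem_of_mem_filter hp), hreg, hrad⟩

end DepthLegal

end Summit.ResolutionOfSingularities.ResolutionOfSingularities.Theorems
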